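import Literature.MathematicalPhysics.QuantumFieldTheory.Balaban1983to89.T4TermwiseTorus
import Literature.MathematicalPhysics.QuantumFieldTheory.Balaban1983to89.T4QuatExpLog
import Literature.MathematicalPhysics.QuantumFieldTheory.Balaban1983to89.B7Prop2SpecialUnitary

/-!
# T⁴ continuum, node U5 (NE7), TERM-WISE member — (id-V) FOR `SU(2)`: the quaternion isometry
# `ℍ ≅ {quaternion matrices} ⊂ M₂(ℂ)` pulls the torus binders (bch)/(tr) of `T4TermwiseTorus` back to the REAL
# INNER-PRODUCT SPACE `V = ℍ` of generation 10, and the `SU(2)` Wilson weight is `1 − cos ‖·‖_ℍ` there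

Lineage t4-ne7-p1 (term-wise matching modulo constants), generation 12, second leaf.  HONEST FRAMING (page 1): pure YM₄
on a FIXED FINITE torus T⁴, rung (B)+1 of the cell's ladder = the `ε → 0` limit of expectations of gauge-invariant
observables; NOT infinite volume, NOT a mass gap, NOT the Clay problem.  Spine estimate NE7 (node U5) is NOT PRINTED for
Bałaban's d = 4 procedure and is NOT proved here.  The conditionals of the lineage — the flow window (0.31) of
[Balaban1987RG1] (the cell's BetaPertH road; tree `Step.Discrete031`), (B), (B^μ) — are untouched by this leaf: they sit
BY NAME in the binders `h031A`/`h031B` of generation 10's capstone `T4TermwiseQuartic.goodClause_summable_of_kindsRA_regular`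
and inside the producers of its other binders; nothing here discharges or hides them.  This leaf is LINEAR ALGEBRA over
the tree's quaternion model of `SU(2)` (`QuantumLattice.SU2Haar.quatMatrix` / `su2Quat`, `T4HaarSU2LocalDiffeo.topRowQuat`,
`T4QuatExpLog.norm_quatMatrix` / `mlog_quatMatrix_mem_range` / `qlog`, cell unit b2b-balaban-pv03's leaves, and
`B7Prop2SpecialUnitary.specialUnitaryUnits` / `bavg_mem_specialUnitaryUnits`, unit b2b-balaban-b07 — all reached BY NAME,
nothing upstream edited): no new estimate, no `sorry`, four bookkeeping definitions (`phiM`, `GM`, `phiQ`/`psiQ`/`PhiQ`,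
`quatIsometry`), every statement [folklore] or a re-indexing of the tree's kernel theorems.

CITATION HEADER (lean-in-tree rule 2026-08-18).  Audit cell `pub-balaban`, sub-cell t4 (unit b2b-balaban-t4-ne7-p1-g12).
Sources.  T. Bałaban, *Averaging operations for lattice gauge theories*, Commun. Math. Phys. **98**, 17–51 (1985)
[Balaban1985Averaging] (cell paper B7; journal page = PDF page + 16; renders `b2b-balaban-ref1/pages/1985-cmp98-averaging/`
pp. 18–19 READ AS IMAGES for this header): p. 18 «Gauge field configurations U are defined on a set of bonds in Ω, and with
values in a Lie subgroup G of a unitary group U(N).» and (7) «U(x, x′) = U⁻¹(x′, x) = U*(x′, x)»; p. 19 «We consider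
configurations U with values in a small neighborhood of the identity of G, hence U = e^{iA} and A is a Lie algebra valued
configuration with values in a small neighborhood of 0.»; the average (42) p. 23 (= (15) p. 19) and Proposition 1 (51) p. 26
exactly as quoted VERBATIM in the header of `B7Prop1Explicit` (v1.0.1).  T. Bałaban, *Renormalization group approach to lattice
gauge field theories. I*, Commun. Math. Phys. **109**, 249–301 (1987) [Balaban1987RG1] (B12): (0.2) p. 252 the Wilson action
`A^ε(U) = Σ_p ε^{d−4}[1 − Re tr U(∂p)]` as transcribed (not quoted) in the cell's `Setup.wilsonAction`, with `Re tr = Re Tr / N`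
(`UnitaryModel.nReTr`; here `N = 2`, written out as `(Matrix.trace U).re / 2`).  Nothing else of the papers is used; the
quaternion model of `SU(2)` is textbook ([MorganSWBook1996] §2.4 Example (ii), the cite carried by `quatMatrixLinear`); no
sentence of this file is a new quotation of print beyond the two p. 18 / one p. 19 sentences above.

## Why this leaf (record `t4/T4-EST-NE7-P1.md` v12 §16 (16c)/(16d)(v): after the first leaf of generation 12,
## "remaining between the lineage's theorems and generation 10's binders AS TYPED = (id-V) (isometry `V →ₗᵢ[ℝ] 𝔸`) +
## the one-call K-bookkeeping" — the record's words, not print)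
Generation 10's `interpolation_averaging_of_regular` is stated over an abstract real inner-product space `V` (fields
`φA ψA ΦA` valued in `V`, weight `e : V → ℝ` with `‖v‖²/2 − q₄‖v‖⁴ ≤ e v ≤ ‖v‖²/2`), while generations 11–12 proved (bch)
and (tr) with values in the Banach algebra `𝔸` of the bond variables.  For `G = SU(2) ⊂ 𝔸 = M₂(ℂ)` (operator norm (19))
the gap closes WITHOUT CONSTANTS: `quatMatrix : ℍ → M₂(ℂ)` is an `ℝ`-linear ISOMETRY onto the quaternion matrices
(`quatIsometry`; `‖quatMatrix q‖ = ‖q‖_ℍ`), every matrix occurring in the binders — bond variables, parallel transports,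
axial gauge functions, the average (42) and its `L`-plaquette variables (all `SU(2)`-valued: §2), their logarithms (21)
(`mlog_val_mem_range`, via `T4QuatExpLog.mlog_quatMatrix_mem_range`) and the transported logarithms — is a quaternion matrix,
and the first row `topRowQuat` inverts the dictionary on them; so `‖topRowQuat A − Σ_x w x • topRowQuat (M x)‖_ℍ =
‖A − Σ_x w x • M x‖` (`norm_topRowQuat_sub_sum`) and (bch)/(tr) hold VERBATIM for the `ℍ`-valued data (§3), `ℍ` being a
real inner-product space (Mathlib).  Moreover the `SU(2)` Wilson weight is a function of the `ℍ`-norm of the pulled-back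
logarithm: `1 − ½ Re Tr U = 1 − cos ‖topRowQuat (log U)‖_ℍ` (`wilsonWeight_eq`: `U = quatMatrix u`, `u = exp (qlog u)`,
`qlog u` imaginary, `re (exp w) = cos ‖w‖`), so generation 10's `e` is `v ↦ 1 − cos ‖v‖` and its weight binder `he` is the
tree's `T4TermwiseQuartic.one_sub_cos_norm_sandwich` (`q₄ = 1/24`).  (For `SU(N)`, `N ≥ 3`, no such isometry exists —
the operator norm on `su(N)` is not Euclidean — and (id-V) costs constants; not treated.)

## What this module adds (additive leaf; imports `T4TermwiseTorus`, `T4QuatExpLog`, `B7Prop2SpecialUnitary` BY NAME)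
§1 `M₂`; `quatIsometry` (`ℍ →ₗᵢ[ℝ] M₂(ℂ)`), `quatMatrix_topRowQuat`, `norm_topRowQuat`, `quatMatrix_real_smul`,
   `quatMatrix_topRowQuat_sub_sum`, **`norm_topRowQuat_sub_sum`** (pull-back of a kernel-sum norm), `mul_mem_range`,
   `mem_range_of_mem_specialUnitaryGroup`, `val_mem_range`, **`mlog_val_mem_range`** (log of `SU(2)` near `1` is a quaternion
   matrix), `re_topRowQuat_mlog_eq_zero` (it is imaginary); `trace_quatMatrix_re`, **`wilsonWeight_eq`**.
§2 `U1_of_SU`, `hol_mem_SU`, `axialFn_mem_SU`, `cplaq_mem_SU`, `theta_bounds`, `mlog_hol_plaqWord_mem_range`,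
   `transport_mem_range`, `textend_mem_range`, **`bavg_mem_SU`** ((42) of an `SU(2)` field is `SU(2)`-valued under (44) +
   Prop. 2 smallness: radius `2θ ≤ 1/32 ≤ 1/4`, `2·¼ < π`), `mlog_cplaq_bavg_mem_range` ((51): `|V̄(∂p′) − 1| < 1`).
§3 **`bch_torus_quat`** ((bch) = `hρA`/`hρB` in `ℍ`), **`norm_topRowQuat_textend`** ((tr) = `hΦA`/`hΦB` in `ℍ`, every `x`),
   `re_data_eq_zero`.
§4 plane-labelled packaging over the fixed index type `(Fin d × Fin d) × ℤ^d` of `T4TermwiseTorus.pbox`: `phiM`, `GM`,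
   **`phiQ`/`psiQ`/`PhiQ`** (generation 10's `φA`/`ψA`/`ΦA` for `SU(2)` as functions into `ℍ`), **`norm_PhiQ`** (`hΦA` for ALL
   pairs), **`bch_PhiQ`** (`hρA` with `Pf = pbox planes T`, `w = pker T L`), `wilson_phiQ_psiQ` (`hreprU`/`hreprL` terms),
   `re_phiQ_psiQ`.
§5 toys (non-vacuity: the constant configuration `1` meets every hypothesis with `α₀ = 0`).

## Binder status for generation 10's `interpolation_averaging_of_regular`, `G = SU(2)` (cumulative, gens 10–12)
(ker) `hw hrow hcol`, (cnt) `hNf hNc`: PRODUCED (`T4TermwiseTorus.kernel_tower`, d = 4).  (tr) `hΦA hΦB`: PRODUCED in `V = ℍ`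
for periodic `SU(2)` configurations, all pairs (`norm_PhiQ`).  (bch) `hρA hρB`: PRODUCED in `V = ℍ` (`bch_PhiQ`, `ρb = 280θ²`,
`T ≥ 2L`, hypotheses (44) + Prop. 2 smallness of the periodic lift).  (id-V): PRODUCED for `SU(2)` (this leaf); OPEN with
constants for `SU(N ≥ 3)`.  (wt) `he` for `SU(2)`: the tree's `one_sub_cos_norm_sandwich` on `V = ℍ` with the dictionary
`wilsonWeight_eq`.  ONE-CALL K-BOOKKEEPING: what remains is to take, at level `K`, `V := ` the `K`-th fine field of runs
A/B, `Pf K := pbox planes (n_K L)`, `Pc K := pbox planes n_K`, `w K := pker (n_K L) L`, `φA K := phiQ V`, `ψA K := psiQ L V`,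
`ΦA K := PhiQ (n_K L) L V`, `ρb K := 280θ_K²` (`T4TermwiseBCH.bchSize_le_scale` for `hρb`) — the binders then read
`kernel_tower`, `norm_PhiQ`, `bch_PhiQ` literally; its remaining inputs are the UNPRINTED ones.
UNCHANGED, still hypotheses upstream (BY NAME where they are declared): (osc-U) the rate-carrying oscillation bound — NOT
PRINTED as an inequality (locus [Balaban1985Variational] pp. 280–286); (W-w); the size law `hs`; (repr) = the identification
of runs A/B's effective actions with `Σ e(φ)`, `Σ e(ψ)` beyond the Wilson terms; (0.31) = `h031A`/`h031B`; (B); (B^μ).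
No new end-to-end theorem is stated; NE7 remains NOT PRINTED and NOT PROVED.

## What is NOT delivered
`SU(N)`, `N ≥ 3` (and `U(1)`, where `V = ℝ` is immediate but not typed here); (osc-U); the literal one-call instantiation
(its other binders are the unprinted ones); optimal constants; anything using more of the papers than the displays above.
-/

noncomputable section

open scoped BigOperators Quaternion Matrix.Norms.L2Operator
open NormedSpace Finset

namespace Literature.MathematicalPhysics.QuantumFieldTheory.Balaban1983to89.T4TermwiseSU2

open B7Prop1Explicit B7Prop2Explicit B7Prop2SpecialUnitary T4TermwiseBCH T4TermwiseTorus
open Literature.MathematicalPhysics.QuantumLattice (quatMatrix quatMatrix_mul quatMatrix_one quatMatrix_smul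
  quatMatrix_su2Quat su2Quat norm_su2Quat)
open Literature.Geometry.GaugeTheory (quatMatrix_add quatMatrix_zero quatMatrixLinear quatMatrixLinear_apply)
open T4HaarSU2LocalDiffeo (topRowQuat topRowQuat_quatMatrix)
open T4QuatExpLog (quatMatrix_sub norm_quatMatrix norm_quatMatrix_sub_one mlog_quatMatrix_mem_range qlog
  qlog_re_of_norm_eq_one)

/-- The algebra `M₂(ℂ)` with the `L²`-OPERATOR NORM (19) (scoped instance `Matrix.Norms.L2Operator`). [folklore] -/
abbrev M₂ : Type := Matrix (Fin 2) (Fin 2) ℂ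

/-! ## §1 The dictionary `ℍ → M₂(ℂ)` as a linear isometry; quaternion matrices pulled back by the first row -/

section Dictionary

/-- `quatMatrix` as an `ℝ`-LINEAR ISOMETRY `ℍ →ₗᵢ[ℝ] M₂(ℂ)` (`L²`-operator norm): the binder `(ι : V →ₗᵢ[ℝ] 𝔸)` of
`T4TermwiseBCH.norm_sub_window_sum_of_isometry` / the inner-product space `V` of `T4TermwiseQuartic` for `SU(2)`,
with `V = ℍ ≅ ℝ⁴` (`InnerProductSpace ℝ ℍ`). [folklore] -/
def quatIsometry : ℍ →ₗᵢ[ℝ] M₂ :=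
  { quatMatrixLinear with norm_map' := fun q => by simpa using norm_quatMatrix q }

/-- `quatIsometry q = quatMatrix q`. [folklore] -/
@[simp] theorem quatIsometry_apply (q : ℍ) : quatIsometry q = quatMatrix q := rfl

/-- `ℍ` is a real inner-product space (Mathlib) — the class of the abstract value space `V` of `T4TermwiseQuartic`. [folklore] -/
example : InnerProductSpace ℝ ℍ := inferInstance

/-- On quaternion matrices the first row inverts the dictionary: `quatMatrix (topRowQuat A) = A`. [folklore] -/
theorem quatMatrix_topRowQuat {A : M₂} (hA : A ∈ Set.range quatMatrix) : quatMatrix (topRowQuat A) = A := by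
  obtain ⟨q, rfl⟩ := hA
  rw [topRowQuat_quatMatrix]

/-- The pull-back preserves the norm of a quaternion matrix: `‖topRowQuat A‖_ℍ = ‖A‖`. [folklore] -/
theorem norm_topRowQuat {A : M₂} (hA : A ∈ Set.range quatMatrix) : ‖topRowQuat A‖ = ‖A‖ := by
  rw [← norm_quatMatrix, quatMatrix_topRowQuat hA]

/-- `quatMatrix (r • q) = r • quatMatrix q` for a REAL scalar (the `ℝ`-module structure of `M₂(ℂ)`). [folklore] -/
theorem quatMatrix_real_smul (r : ℝ) (q : ℍ) : quatMatrix (r • q) = r • quatMatrix q := by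
  rw [quatMatrix_smul, Complex.coe_smul]

/-- The dictionary applied to a pulled-back KERNEL SUM: for quaternion matrices `A`, `M x`,
`quatMatrix (topRowQuat A − Σ_x w x • topRowQuat (M x)) = A − Σ_x w x • M x`. [folklore] -/
theorem quatMatrix_topRowQuat_sub_sum {X : Type*} (s : Finset X) (w : X → ℝ) {A : M₂} {M : X → M₂}
    (hA : A ∈ Set.range quatMatrix) (hM : ∀ x ∈ s, M x ∈ Set.range quatMatrix) :
    quatMatrix (topRowQuat A - ∑ x ∈ s, w x • topRowQuat (M x)) = A - ∑ x ∈ s, w x • M x := by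
  rw [quatMatrix_sub, quatMatrix_topRowQuat hA, T4HaarSU2Translate.quatMatrix_sum]
  congr 1
  refine Finset.sum_congr rfl fun x hx => ?_
  rw [quatMatrix_real_smul, quatMatrix_topRowQuat (hM x hx)]

/-- **Pull-back of a kernel-sum estimate to `ℍ`**: for quaternion matrices `A`, `M x`,
`‖topRowQuat A − Σ_x w x • topRowQuat (M x)‖_ℍ = ‖A − Σ_x w x • M x‖` (`quatMatrix` is an `ℝ`-linear isometry,
inverted by `topRowQuat` on its range). [folklore] -/
theorem norm_topRowQuat_sub_sum {X : Type*} (s : Finset X) (w : X → ℝ) {A : M₂} {M : X → M₂}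
    (hA : A ∈ Set.range quatMatrix) (hM : ∀ x ∈ s, M x ∈ Set.range quatMatrix) :
    ‖topRowQuat A - ∑ x ∈ s, w x • topRowQuat (M x)‖ = ‖A - ∑ x ∈ s, w x • M x‖ := by
  rw [← norm_quatMatrix, quatMatrix_topRowQuat_sub_sum s w hA hM]

/-- Products of quaternion matrices are quaternion matrices. [folklore] -/
theorem mul_mem_range {A B : M₂} (hA : A ∈ Set.range quatMatrix) (hB : B ∈ Set.range quatMatrix) :
    A * B ∈ Set.range quatMatrix := by
  obtain ⟨p, rfl⟩ := hA
  obtain ⟨q, rfl⟩ := hB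
  exact ⟨p * q, quatMatrix_mul p q⟩

/-- Every `SU(2)` matrix is a quaternion matrix (of a unit quaternion: `SU2Haar.quatMatrix_su2Quat`). [folklore] -/
theorem mem_range_of_mem_specialUnitaryGroup {A : M₂} (hA : A ∈ Matrix.specialUnitaryGroup (Fin 2) ℂ) :
    A ∈ Set.range quatMatrix :=
  ⟨su2Quat ⟨A, hA⟩, quatMatrix_su2Quat ⟨A, hA⟩⟩

/-- The value of an `SU(2)`-valued unit is a quaternion matrix. [folklore] -/
theorem val_mem_range {U : M₂ˣ} (hU : U ∈ specialUnitaryUnits (Fin 2)) : (U : M₂) ∈ Set.range quatMatrix :=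
  mem_range_of_mem_specialUnitaryGroup hU

/-- **The logarithm (21) of an `SU(2)` matrix within `1` of the identity is a quaternion matrix** (it is
`quatMatrix (qlog u)`, `T4QuatExpLog.mlog_quatMatrix_mem_range`). [folklore] -/
theorem mlog_val_mem_range {U : M₂ˣ} (hU : U ∈ specialUnitaryUnits (Fin 2)) (h1 : ‖(U : M₂) - 1‖ < 1) :
    MatrixLog.mlog (U : M₂) ∈ Set.range quatMatrix := by
  obtain ⟨q, hq⟩ := val_mem_range hU
  rw [← hq] at h1 ⊢
  rw [norm_quatMatrix_sub_one] at h1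
  exact mlog_quatMatrix_mem_range h1

/-- The pulled-back logarithm of an `SU(2)` matrix near `1` is an IMAGINARY quaternion (`su(2) ≅ Im ℍ ≅ ℝ³`):
`re (topRowQuat (log U)) = 0`. [folklore] -/
theorem re_topRowQuat_mlog_eq_zero {U : M₂ˣ} (hU : U ∈ specialUnitaryUnits (Fin 2)) (h1 : ‖(U : M₂) - 1‖ < 1) :
    (topRowQuat (MatrixLog.mlog (U : M₂))).re = 0 := by
  have hq : quatMatrix (su2Quat ⟨(U : M₂), hU⟩) = (U : M₂) := quatMatrix_su2Quat ⟨(U : M₂), hU⟩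
  have h1' : ‖su2Quat ⟨(U : M₂), hU⟩ - 1‖ < 1 := by rwa [← norm_quatMatrix_sub_one, hq]
  have h := qlog_re_of_norm_eq_one (norm_su2Quat ⟨(U : M₂), hU⟩) h1'
  rwa [qlog, hq] at h


/-! ### The Wilson weight of an `SU(2)` plaquette in the quaternion picture -/

/-- `Re Tr (quatMatrix q) = 2 re q`. [folklore] -/
theorem trace_quatMatrix_re (q : ℍ) : (Matrix.trace (quatMatrix q)).re = 2 * q.re := by
  rw [Matrix.trace_fin_two, Literature.MathematicalPhysics.QuantumLattice.quatMatrix_apply_00,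
    Literature.MathematicalPhysics.QuantumLattice.quatMatrix_apply_11, Complex.add_re]
  ring

/-- **The Wilson weight is `1 − cos` of the norm of the pulled-back logarithm:** for `U ∈ SU(2)` with `|U − 1| < 1`,
`1 − ½ Re Tr U = 1 − cos ‖topRowQuat (log U)‖_ℍ` (`U = quatMatrix u`, `u = exp (qlog u)` with `qlog u` imaginary, and
`re (exp w) = cos ‖w‖` for imaginary `w`).  With `e v := 1 − cos ‖v‖` on `V = ℍ` this is the representation binder
`hreprU`/`hreprL` term of `T4TermwiseQuartic.interpolation_averaging_of_regular` for the `SU(2)` Wilson action, and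
`T4TermwiseQuartic.one_sub_cos_norm_sandwich` is its weight binder `he` (with `q₄ = 1/24`). [folklore] -/
theorem wilsonWeight_eq {U : M₂ˣ} (hU : U ∈ specialUnitaryUnits (Fin 2)) (h1 : ‖(U : M₂) - 1‖ < 1) :
    1 - (Matrix.trace (U : M₂)).re / 2 = 1 - Real.cos ‖topRowQuat (MatrixLog.mlog (U : M₂))‖ := by
  have hq : quatMatrix (su2Quat ⟨(U : M₂), hU⟩) = (U : M₂) := quatMatrix_su2Quat ⟨(U : M₂), hU⟩
  have h1' : ‖su2Quat ⟨(U : M₂), hU⟩ - 1‖ < 1 := by rwa [← norm_quatMatrix_sub_one, hq]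
  have hre : (qlog (su2Quat ⟨(U : M₂), hU⟩)).re = 0 :=
    qlog_re_of_norm_eq_one (norm_su2Quat ⟨(U : M₂), hU⟩) h1'
  have hlog : topRowQuat (MatrixLog.mlog (U : M₂)) = qlog (su2Quat ⟨(U : M₂), hU⟩) := by
    rw [qlog, hq]
  have hure : (su2Quat ⟨(U : M₂), hU⟩).re = Real.cos ‖qlog (su2Quat ⟨(U : M₂), hU⟩)‖ := by
    have h := Quaternion.re_exp (qlog (su2Quat ⟨(U : M₂), hU⟩))
    rw [T4QuatExpLog.exp_qlog h1', hre, Quaternion.coe_zero, sub_zero, NormedSpace.exp_zero, one_mul] at h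
    exact h
  rw [hlog, ← hure]
  conv_lhs => rw [← hq, trace_quatMatrix_re]
  ring

end Dictionary

/-! ## §2 `SU(2)`-valued configurations: every matrix the term-wise binders mention is a quaternion matrix -/

section Config

variable {d : ℕ}

/-- `SU(2)`-valued bond variables are norm-bounded units (19) (`B7Prop2SpecialUnitary.specialUnitaryUnits_le_U1`). [folklore] -/
theorem U1_of_SU {V : B7Prop1Explicit.Site d → Fin d → M₂ˣ} (hV : ∀ x κ, V x κ ∈ specialUnitaryUnits (Fin 2)) (x : B7Prop1Explicit.Site d)
    (κ : Fin d) : V x κ ∈ U1 M₂ :=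
  specialUnitaryUnits_le_U1 (hV x κ)

/-- Parallel transports (9) of an `SU(2)`-valued configuration are `SU(2)`-valued. [folklore] -/
theorem hol_mem_SU {V : B7Prop1Explicit.Site d → Fin d → M₂ˣ} (hV : ∀ x κ, V x κ ∈ specialUnitaryUnits (Fin 2)) (x : B7Prop1Explicit.Site d)
    (w : List (Letter d)) : hol V x w ∈ specialUnitaryUnits (Fin 2) :=
  hol_mem_of hV x w

/-- The axial gauge function (p. 24) of an `SU(2)`-valued configuration is `SU(2)`-valued. [folklore] -/
theorem axialFn_mem_SU {V : B7Prop1Explicit.Site d → Fin d → M₂ˣ} (hV : ∀ x κ, V x κ ∈ specialUnitaryUnits (Fin 2))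
    (y x : B7Prop1Explicit.Site d) : axialFn V y x ∈ specialUnitaryUnits (Fin 2) :=
  hol_mem_of hV _ _

/-- The `L`-plaquette variable of an `SU(2)`-valued `L`-lattice configuration is `SU(2)`-valued. [folklore] -/
theorem cplaq_mem_SU (L : ℕ) {W : B7Prop1Explicit.Site d → Fin d → M₂ˣ} (hW : ∀ x κ, W x κ ∈ specialUnitaryUnits (Fin 2))
    (z : B7Prop1Explicit.Site d) (μ ν : Fin d) : cplaq L W z μ ν ∈ specialUnitaryUnits (Fin 2) := by
  unfold cplaq
  exact Subgroup.mul_mem _ (Subgroup.mul_mem _ (Subgroup.mul_mem _ (hW _ _) (hW _ _))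
    (Subgroup.inv_mem _ (hW _ _))) (Subgroup.inv_mem _ (hW _ _))

/-- The smallness bookkeeping: `512(d+1)(d+4)L²α₀ ≤ 1`, `L ≥ 1` ⟹ `θ := 8(d+1)(d+4)L²α₀ ≤ 1/64`, `α₀ ≤ θ`,
`L²α₀ ≤ θ`. [folklore] -/
theorem theta_bounds {L : ℕ} (hL : 1 ≤ L) {α₀ : ℝ} (hα₀ : 0 ≤ α₀)
    (hsmall : 512 * (d + 1) * (d + 4) * (L : ℝ) ^ 2 * α₀ ≤ 1) :
    8 * (d + 1) * (d + 4) * (L : ℝ) ^ 2 * α₀ ≤ 1 / 64 ∧ α₀ ≤ 8 * (d + 1) * (d + 4) * (L : ℝ) ^ 2 * α₀ ∧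
      (L : ℝ) ^ 2 * α₀ ≤ 8 * (d + 1) * (d + 4) * (L : ℝ) ^ 2 * α₀ := by
  have hL' : (1 : ℝ) ≤ L := by exact_mod_cast hL
  have hL2 : (1 : ℝ) ≤ (L : ℝ) ^ 2 := one_le_pow₀ hL'
  have hd : (0 : ℝ) ≤ d := Nat.cast_nonneg d
  have hA : (1 : ℝ) ≤ 8 * ((d : ℝ) + 1) * (d + 4) := by nlinarith
  have h1 : (1 : ℝ) ≤ 8 * ((d : ℝ) + 1) * (d + 4) * (L : ℝ) ^ 2 := by
    calc (1 : ℝ) = 1 * 1 := by ring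
      _ ≤ 8 * ((d : ℝ) + 1) * (d + 4) * (L : ℝ) ^ 2 := mul_le_mul hA hL2 zero_le_one (by positivity)
  refine ⟨?_, ?_, ?_⟩
  · have h : 8 * (d + 1) * (d + 4) * (L : ℝ) ^ 2 * α₀ = (512 * (d + 1) * (d + 4) * (L : ℝ) ^ 2 * α₀) / 64 := by
      ring
    rw [h]
    linarith
  · calc α₀ = 1 * α₀ := by ring
      _ ≤ 8 * ((d : ℝ) + 1) * (d + 4) * (L : ℝ) ^ 2 * α₀ := mul_le_mul_of_nonneg_right h1 hα₀
  · have h2 : 0 ≤ (L : ℝ) ^ 2 * α₀ := by positivity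
    calc (L : ℝ) ^ 2 * α₀ = 1 * ((L : ℝ) ^ 2 * α₀) := by ring
      _ ≤ 8 * ((d : ℝ) + 1) * (d + 4) * ((L : ℝ) ^ 2 * α₀) := mul_le_mul_of_nonneg_right hA h2
      _ = 8 * ((d : ℝ) + 1) * (d + 4) * (L : ℝ) ^ 2 * α₀ := by ring

/-- Under (44) with the Prop. 2 smallness every plaquette variable is within `1` of the identity, so its logarithm
(21) is a quaternion matrix. [folklore] -/
theorem mlog_hol_plaqWord_mem_range {V : B7Prop1Explicit.Site d → Fin d → M₂ˣ} (hV : ∀ x κ, V x κ ∈ specialUnitaryUnits (Fin 2))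
    {L : ℕ} (hL : 1 ≤ L) {α₀ : ℝ} (hα₀ : 0 ≤ α₀) (hsmall : 512 * (d + 1) * (d + 4) * (L : ℝ) ^ 2 * α₀ ≤ 1)
    (h44 : ∀ (x : B7Prop1Explicit.Site d) (κ κ' : Fin d), κ ≠ κ' → ‖((hol V x (plaqWord κ κ') : M₂ˣ) : M₂) - 1‖ ≤ α₀)
    {μ ν : Fin d} (hμν : μ ≠ ν) (x : B7Prop1Explicit.Site d) :
    MatrixLog.mlog ((hol V x (plaqWord μ ν) : M₂ˣ) : M₂) ∈ Set.range quatMatrix := by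
  obtain ⟨hθ, hαθ, -⟩ := theta_bounds hL hα₀ hsmall
  exact mlog_val_mem_range (hol_mem_SU hV x _) (by linarith [h44 x μ ν hμν])

/-- The TRANSPORTED logarithm `((u z)⁻¹ u x') · A · ((u z)⁻¹ u x')⁻¹` of a quaternion matrix `A` by the axial gauge
function `u = axialFn V y` of an `SU(2)`-valued configuration is a quaternion matrix. [folklore] -/
theorem transport_mem_range {V : B7Prop1Explicit.Site d → Fin d → M₂ˣ} (hV : ∀ x κ, V x κ ∈ specialUnitaryUnits (Fin 2))
    (y z x' : B7Prop1Explicit.Site d) {A : M₂} (hA : A ∈ Set.range quatMatrix) :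
    ((((axialFn V y z)⁻¹ * axialFn V y x' : M₂ˣ)) : M₂) * A
        * ((((axialFn V y z)⁻¹ * axialFn V y x')⁻¹ : M₂ˣ) : M₂) ∈ Set.range quatMatrix := by
  have hT : (axialFn V y z)⁻¹ * axialFn V y x' ∈ specialUnitaryUnits (Fin 2) :=
    Subgroup.mul_mem _ (Subgroup.inv_mem _ (axialFn_mem_SU hV y z)) (axialFn_mem_SU hV y x')
  exact mul_mem_range (mul_mem_range (val_mem_range hT) hA) (val_mem_range (Subgroup.inv_mem _ hT))

/-- Every value of the torus transport `textend` (run A's `Φ_A(p′, ·)` of `T4TermwiseTorus`) built from an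
`SU(2)`-valued configuration under (44) is a quaternion matrix. [folklore] -/
theorem textend_mem_range (T L : ℕ) (μ ν : Fin d) {V : B7Prop1Explicit.Site d → Fin d → M₂ˣ}
    (hV : ∀ x κ, V x κ ∈ specialUnitaryUnits (Fin 2)) (hL : 1 ≤ L) {α₀ : ℝ} (hα₀ : 0 ≤ α₀)
    (hsmall : 512 * (d + 1) * (d + 4) * (L : ℝ) ^ 2 * α₀ ≤ 1)
    (h44 : ∀ (x : B7Prop1Explicit.Site d) (κ κ' : Fin d), κ ≠ κ' → ‖((hol V x (plaqWord κ κ') : M₂ˣ) : M₂) - 1‖ ≤ α₀)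
    (hμν : μ ≠ ν) (z y : B7Prop1Explicit.Site d) (u : B7Prop1Explicit.Site d → M₂ˣ) (hu : u = axialFn V y)
    (φ : B7Prop1Explicit.Site d → M₂) (hφ : φ = fun x => MatrixLog.mlog ((hol V x (plaqWord μ ν) : M₂ˣ) : M₂))
    (G : B7Prop1Explicit.Site d → M₂) (hG : G = fun x' => ((((u z)⁻¹ * u x' : M₂ˣ)) : M₂) * φ x'
        * ((((u z)⁻¹ * u x')⁻¹ : M₂ˣ) : M₂)) (x : B7Prop1Explicit.Site d) :
    textend T L μ ν z G φ x ∈ Set.range quatMatrix := by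
  have hφr : ∀ x', φ x' ∈ Set.range quatMatrix := fun x' => by
    rw [hφ]
    exact mlog_hol_plaqWord_mem_range hV hL hα₀ hsmall h44 hμν x'
  unfold textend
  split_ifs with h
  · rw [hG, hu]
    exact transport_mem_range hV y z _ (hφr _)
  · exact hφr x

/-- Under (44) with the Prop. 2 smallness the average (42) of an `SU(2)`-valued configuration is `SU(2)`-valued
(`B7Prop2SpecialUnitary.bavg_mem_specialUnitaryUnits` at radius `1/4`, `2 · ¼ < π`; the `log`-arguments are within
`2θ ≤ 1/32` of `1` by `B7Prop2Explicit.norm_Wcx_sub_one_le`). [cite: Balaban1985Averaging, (42) p.23] -/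
theorem bavg_mem_SU {V : B7Prop1Explicit.Site d → Fin d → M₂ˣ} (hV : ∀ x κ, V x κ ∈ specialUnitaryUnits (Fin 2))
    (L : ℕ) (hL : 1 ≤ L) {α₀ : ℝ} (hα₀ : 0 ≤ α₀) (hsmall : 512 * (d + 1) * (d + 4) * (L : ℝ) ^ 2 * α₀ ≤ 1)
    (h44 : ∀ (x : B7Prop1Explicit.Site d) (κ κ' : Fin d), κ ≠ κ' → ‖((hol V x (plaqWord κ κ') : M₂ˣ) : M₂) - 1‖ ≤ α₀) :
    ∀ q κ, bavg L V q κ ∈ specialUnitaryUnits (Fin 2) := by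
  intro q κ
  obtain ⟨hθ, -, -⟩ := theta_bounds hL hα₀ hsmall
  refine bavg_mem_specialUnitaryUnits hV L q κ (t := 1 / 4) le_rfl ?_ fun r => ?_
  · have hπ : (3 : ℝ) < Real.pi := Real.pi_gt_three
    simp only [Fintype.card_fin, Nat.cast_ofNat]
    linarith
  · exact (norm_Wcx_sub_one_le L hL V (U1_of_SU hV) hα₀ hsmall h44 q κ r).trans (by linarith)

/-- Under (44) with the Prop. 2 smallness the `L`-plaquette variable `V̄(∂p′)` of the average (42) is an `SU(2)`
matrix within `1` of the identity (Proposition 1 (51): `|V̄(∂p′) − 1| ≤ L²α₀ + 226θ² < 1`), so `log V̄(∂p′)` is a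
quaternion matrix. [cite: Balaban1985Averaging, Prop. 1 (51) p.26] -/
theorem mlog_cplaq_bavg_mem_range {V : B7Prop1Explicit.Site d → Fin d → M₂ˣ} (hV : ∀ x κ, V x κ ∈ specialUnitaryUnits (Fin 2))
    (L : ℕ) (hL : 1 ≤ L) {α₀ : ℝ} (hα₀ : 0 ≤ α₀) (hsmall : 512 * (d + 1) * (d + 4) * (L : ℝ) ^ 2 * α₀ ≤ 1)
    (h44 : ∀ (x : B7Prop1Explicit.Site d) (κ κ' : Fin d), κ ≠ κ' → ‖((hol V x (plaqWord κ κ') : M₂ˣ) : M₂) - 1‖ ≤ α₀)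
    (z : B7Prop1Explicit.Site d) {μ ν : Fin d} (hμν : μ ≠ ν) :
    ‖((cplaq L (bavg L V) z μ ν : M₂ˣ) : M₂) - 1‖ < 1 ∧
      MatrixLog.mlog ((cplaq L (bavg L V) z μ ν : M₂ˣ) : M₂) ∈ Set.range quatMatrix := by
  obtain ⟨hθ, -, hLα⟩ := theta_bounds hL hα₀ hsmall
  have h51 := prop1_explicit L hL z hμν V (U1_of_SU hV) hα₀ hsmall h44
  have hlt : ‖((cplaq L (bavg L V) z μ ν : M₂ˣ) : M₂) - 1‖ < 1 := by
    have hsq : (8 * (d + 1) * (d + 4) * (L : ℝ) ^ 2 * α₀) ^ 2 ≤ (1 / 64) ^ 2 :=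
      pow_le_pow_left₀ (by positivity) hθ 2
    linarith
  exact ⟨hlt, mlog_val_mem_range (cplaq_mem_SU L (bavg_mem_SU hV L hL hα₀ hsmall h44) z μ ν) hlt⟩

end Config

/-! ## §3 The term-wise binders (bch)/(tr) of NE7 with values in `V = ℍ`: (id-V) for `SU(2)` -/

section Binders

variable {d : ℕ} (T L : ℕ) (μ ν : Fin d)

/-- **(bch) in `ℍ` — the kernel-form binder `hρA`/`hρB` of `T4TermwiseQuartic.interpolation_averaging_of_regular`
for Bałaban's concrete average (42) of an `SU(2)`-VALUED periodic configuration, with values in the real inner-product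
space `V = ℍ`:** with `ψ(p′) := topRowQuat (log V̄(∂p′))` and `Φ(p′, x) := topRowQuat (Φ_A(p′, x))`,
`‖ψ(p′) − Σ_{x ∈ [0,T)^d} w(a, x) • Φ(p′, x)‖_ℍ ≤ 280 θ²`, `θ = 8(d+1)(d+4)L²α₀` — `T4TermwiseTorus.bch_torus` pulled
back along the linear isometry `quatMatrix : ℍ → M₂(ℂ)` (every matrix in the estimate is a quaternion matrix, §2).
Finite torus, (44) + Prop. 2 smallness explicit; not an estimate printed in [Balaban1985Averaging] (its (bch) input is
the tree's kernel theorem `T4TermwiseBCH.bch_concrete`). [folklore] -/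
theorem bch_torus_quat (hL : 1 ≤ L) (h2L : 2 * L ≤ T) (a : B7Prop1Explicit.Site d) (hμν : μ ≠ ν)
    (V : B7Prop1Explicit.Site d → Fin d → M₂ˣ) (hV : ∀ x κ, V x κ ∈ specialUnitaryUnits (Fin 2)) {α₀ : ℝ} (hα₀ : 0 ≤ α₀)
    (hsmall : 512 * (d + 1) * (d + 4) * (L : ℝ) ^ 2 * α₀ ≤ 1)
    (h44 : ∀ (x : B7Prop1Explicit.Site d) (κ κ' : Fin d), κ ≠ κ' → ‖((hol V x (plaqWord κ κ') : M₂ˣ) : M₂) - 1‖ ≤ α₀)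
    (u : B7Prop1Explicit.Site d → M₂ˣ) (hu : u = axialFn V ((L : ℤ) • a + (L : ℤ) • e μ + (L : ℤ) • e ν))
    (φ : B7Prop1Explicit.Site d → M₂) (hφ : φ = fun x => MatrixLog.mlog ((hol V x (plaqWord μ ν) : M₂ˣ) : M₂))
    (G : B7Prop1Explicit.Site d → M₂) (hG : G = fun x' => ((((u ((L : ℤ) • a))⁻¹ * u x' : M₂ˣ)) : M₂) * φ x'
        * ((((u ((L : ℤ) • a))⁻¹ * u x')⁻¹ : M₂ˣ) : M₂)) :
    ‖topRowQuat (MatrixLog.mlog ((cplaq L (bavg L V) ((L : ℤ) • a) μ ν : M₂ˣ) : M₂))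
        - ∑ x ∈ box T, tker T L μ ν a x • topRowQuat (textend T L μ ν ((L : ℤ) • a) G φ x)‖
      ≤ 280 * (8 * (d + 1) * (d + 4) * (L : ℝ) ^ 2 * α₀) ^ 2 := by
  rw [norm_topRowQuat_sub_sum (box T) (tker T L μ ν a)
    (mlog_cplaq_bavg_mem_range hV L hL hα₀ hsmall h44 _ hμν).2
    (fun x _ => textend_mem_range T L μ ν hV hL hα₀ hsmall h44 hμν _ _ u hu φ hφ G hG x)]
  exact bch_torus T L μ ν hL h2L a hμν V (U1_of_SU hV) hα₀ hsmall h44 u hu φ hφ G hG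

/-- **(tr) in `ℍ` — the binder `hΦA`/`hΦB` AT EVERY `x`:** for a `T`-periodic `SU(2)`-valued configuration under
(44), `‖topRowQuat (Φ_A(p′, x))‖_ℍ = ‖log V(∂p_x)‖ = ‖topRowQuat (log V(∂p_x))‖_ℍ` (`T4TermwiseTorus.norm_textend_transport`
and the isometry). [folklore] -/
theorem norm_topRowQuat_textend (z y : B7Prop1Explicit.Site d) {V : B7Prop1Explicit.Site d → Fin d → M₂ˣ}
    (hV : ∀ x κ, V x κ ∈ specialUnitaryUnits (Fin 2)) (hper : IsPeriodic T V) (hL : 1 ≤ L) {α₀ : ℝ}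
    (hα₀ : 0 ≤ α₀) (hsmall : 512 * (d + 1) * (d + 4) * (L : ℝ) ^ 2 * α₀ ≤ 1)
    (h44 : ∀ (x : B7Prop1Explicit.Site d) (κ κ' : Fin d), κ ≠ κ' → ‖((hol V x (plaqWord κ κ') : M₂ˣ) : M₂) - 1‖ ≤ α₀)
    (hμν : μ ≠ ν) (u : B7Prop1Explicit.Site d → M₂ˣ) (hu : u = axialFn V y)
    (φ : B7Prop1Explicit.Site d → M₂) (hφ : φ = fun x => MatrixLog.mlog ((hol V x (plaqWord μ ν) : M₂ˣ) : M₂))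
    (G : B7Prop1Explicit.Site d → M₂) (hG : G = fun x' => ((((u z)⁻¹ * u x' : M₂ˣ)) : M₂) * φ x' * ((((u z)⁻¹ * u x')⁻¹ : M₂ˣ) : M₂))
    (x : B7Prop1Explicit.Site d) :
    ‖topRowQuat (textend T L μ ν z G φ x)‖ = ‖φ x‖ ∧ ‖topRowQuat (φ x)‖ = ‖φ x‖ := by
  refine ⟨?_, norm_topRowQuat ?_⟩
  · rw [norm_topRowQuat (textend_mem_range T L μ ν hV hL hα₀ hsmall h44 hμν z y u hu φ hφ G hG x)]
    exact norm_textend_transport T L μ ν z y (U1_of_SU hV) hper u hu φ hφ G hG x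
  · rw [hφ]
    exact mlog_hol_plaqWord_mem_range hV hL hα₀ hsmall h44 hμν x

/-- The pulled-back data are IMAGINARY quaternions (`su(2) ≅ Im ℍ ≅ ℝ³`): `re ψ(p′) = 0` and `re (topRowQuat (log V(∂p_x))) = 0`.
[folklore] -/
theorem re_data_eq_zero {V : B7Prop1Explicit.Site d → Fin d → M₂ˣ} (hV : ∀ x κ, V x κ ∈ specialUnitaryUnits (Fin 2))
    (hL : 1 ≤ L) {α₀ : ℝ} (hα₀ : 0 ≤ α₀) (hsmall : 512 * (d + 1) * (d + 4) * (L : ℝ) ^ 2 * α₀ ≤ 1)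
    (h44 : ∀ (x : B7Prop1Explicit.Site d) (κ κ' : Fin d), κ ≠ κ' → ‖((hol V x (plaqWord κ κ') : M₂ˣ) : M₂) - 1‖ ≤ α₀)
    (hμν : μ ≠ ν) (z x : B7Prop1Explicit.Site d) :
    (topRowQuat (MatrixLog.mlog ((cplaq L (bavg L V) z μ ν : M₂ˣ) : M₂))).re = 0 ∧
      (topRowQuat (MatrixLog.mlog ((hol V x (plaqWord μ ν) : M₂ˣ) : M₂))).re = 0 := by
  obtain ⟨hθ, hαθ, -⟩ := theta_bounds hL hα₀ hsmall
  exact ⟨re_topRowQuat_mlog_eq_zero (cplaq_mem_SU L (bavg_mem_SU hV L hL hα₀ hsmall h44) z μ ν)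
      (mlog_cplaq_bavg_mem_range hV L hL hα₀ hsmall h44 z hμν).1,
    re_topRowQuat_mlog_eq_zero (hol_mem_SU hV x _) (by linarith [h44 x μ ν hμν])⟩

end Binders

/-! ## §4 Plane-labelled packaging: generation 10's `φA`, `ψA`, `ΦA` for `SU(2)` as FUNCTIONS into `V = ℍ`
over the fixed index type `(Fin d × Fin d) × ℤ^d` of `T4TermwiseTorus.pbox`, and their binders at one tower level -/

section Planes

variable {d : ℕ}

/-- The matrix-valued fine datum of a plane `P = (μ, ν)`: `x ↦ log V(∂p_x)`, `p_x` the unit plaquette at `x` in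
the plane `P`. [folklore] -/
def phiM (V : B7Prop1Explicit.Site d → Fin d → M₂ˣ) (P : Fin d × Fin d) : B7Prop1Explicit.Site d → M₂ :=
  fun x => MatrixLog.mlog ((hol V x (plaqWord P.1 P.2) : M₂ˣ) : M₂)

/-- The matrix-valued TRANSPORTED fine datum attached to the coarse plaquette `y = (P, a)` (corner `L•a` on the fine
lattice): `x' ↦ T(x') · log V(∂p_{x'}) · T(x')⁻¹`, `T(x') = u(L•a)⁻¹ u(x')`, `u` the axial gauge function based at the
far corner `L•a + L•e_μ + L•e_ν` (the transport of `T4TermwiseBCH.bch_concrete` / `T4TermwiseTorus.bch_torus`). [folklore] -/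
def GM (L : ℕ) (V : B7Prop1Explicit.Site d → Fin d → M₂ˣ) (y : (Fin d × Fin d) × B7Prop1Explicit.Site d) :
    B7Prop1Explicit.Site d → M₂ :=
  fun x' =>
    ((((axialFn V ((L : ℤ) • y.2 + (L : ℤ) • e y.1.1 + (L : ℤ) • e y.1.2) ((L : ℤ) • y.2))⁻¹
          * axialFn V ((L : ℤ) • y.2 + (L : ℤ) • e y.1.1 + (L : ℤ) • e y.1.2) x' : M₂ˣ)) : M₂)
      * phiM V y.1 x'
      * ((((axialFn V ((L : ℤ) • y.2 + (L : ℤ) • e y.1.1 + (L : ℤ) • e y.1.2) ((L : ℤ) • y.2))⁻¹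
          * axialFn V ((L : ℤ) • y.2 + (L : ℤ) • e y.1.1 + (L : ℤ) • e y.1.2) x')⁻¹ : M₂ˣ) : M₂)

/-- **Generation 10's `φA K · x` for `SU(2)`, valued in `V = ℍ`:** `φ_Q(x) := topRowQuat (log V(∂p_x))` for the
plane-labelled fine plaquette `x = ((μ, ν), site)`. [folklore] -/
def phiQ (V : B7Prop1Explicit.Site d → Fin d → M₂ˣ) (x : (Fin d × Fin d) × B7Prop1Explicit.Site d) : ℍ :=
  topRowQuat (phiM V x.1 x.2)

/-- **Generation 10's `ψA K · y` for `SU(2)`, valued in `V = ℍ`:** `ψ_Q(y) := topRowQuat (log V̄(∂p′_y))`, `p′_y` the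
`L`-plaquette of the averaged field (42) with corner `L•a` in the plane `(μ, ν)`, `y = ((μ, ν), a)`. [folklore] -/
def psiQ (L : ℕ) (V : B7Prop1Explicit.Site d → Fin d → M₂ˣ) (y : (Fin d × Fin d) × B7Prop1Explicit.Site d) : ℍ :=
  topRowQuat (MatrixLog.mlog ((cplaq L (bavg L V) ((L : ℤ) • y.2) y.1.1 y.1.2 : M₂ˣ) : M₂))

/-- **Generation 10's `ΦA K · y x` for `SU(2)`, valued in `V = ℍ`:** in the plane of `y` the pulled-back torus
transport `topRowQuat (textend …)` of `T4TermwiseTorus` (run A's `Φ_A(p′_y, x)`); OFF the plane of `y` (where the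
kernel `pker` vanishes) simply `φ_Q(x)`, so that the norm identity `hΦA` holds for every pair. [folklore] -/
def PhiQ (T L : ℕ) (V : B7Prop1Explicit.Site d → Fin d → M₂ˣ) (y x : (Fin d × Fin d) × B7Prop1Explicit.Site d) : ℍ :=
  if x.1 = y.1 then topRowQuat (textend T L y.1.1 y.1.2 ((L : ℤ) • y.2) (GM L V y) (phiM V y.1) x.2) else phiQ V x

/-- **`hΦA`/`hΦB` for `SU(2)` (plane-labelled, one tower level):** for a `T`-periodic `SU(2)`-valued configuration
under (44) with the Prop. 2 smallness, `‖Φ_Q(y, x)‖_ℍ = ‖φ_Q(x)‖_ℍ` for every coarse label `y` whose plane is a genuine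
plane (`μ ≠ ν`) and EVERY fine label `x`. [folklore] -/
theorem norm_PhiQ (T L : ℕ) {V : B7Prop1Explicit.Site d → Fin d → M₂ˣ}
    (hV : ∀ x κ, V x κ ∈ specialUnitaryUnits (Fin 2)) (hper : IsPeriodic T V) (hL : 1 ≤ L) {α₀ : ℝ}
    (hα₀ : 0 ≤ α₀) (hsmall : 512 * (d + 1) * (d + 4) * (L : ℝ) ^ 2 * α₀ ≤ 1)
    (h44 : ∀ (x : B7Prop1Explicit.Site d) (κ κ' : Fin d), κ ≠ κ' → ‖((hol V x (plaqWord κ κ') : M₂ˣ) : M₂) - 1‖ ≤ α₀)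
    (y : (Fin d × Fin d) × B7Prop1Explicit.Site d) (hy : y.1.1 ≠ y.1.2) (x : (Fin d × Fin d) × B7Prop1Explicit.Site d) :
    ‖PhiQ T L V y x‖ = ‖phiQ V x‖ := by
  unfold PhiQ
  split_ifs with hx
  · have h := norm_topRowQuat_textend T L y.1.1 y.1.2 ((L : ℤ) • y.2)
      ((L : ℤ) • y.2 + (L : ℤ) • e y.1.1 + (L : ℤ) • e y.1.2) hV hper hL hα₀ hsmall h44 hy _ rfl
      (phiM V y.1) rfl (GM L V y) rfl x.2
    rw [h.1, phiQ, hx, h.2]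
  · rfl

/-- **`hρA`/`hρB` for `SU(2)` (plane-labelled, one tower level), the (bch) binder with values in `V = ℍ`:**
`‖ψ_Q(y) − Σ_{x ∈ planes × [0,T)^d} pker(y, x) • Φ_Q(y, x)‖_ℍ ≤ 280 θ²`, `θ = 8(d+1)(d+4)L²α₀`, for every coarse label
`y` with plane in `planes` (all genuine), fine torus period `T ≥ 2L`. [folklore] -/
theorem bch_PhiQ (T L : ℕ) (planes : Finset (Fin d × Fin d)) (hplanes : ∀ P ∈ planes, P.1 ≠ P.2)
    {V : B7Prop1Explicit.Site d → Fin d → M₂ˣ} (hV : ∀ x κ, V x κ ∈ specialUnitaryUnits (Fin 2)) (hL : 1 ≤ L)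
    (h2L : 2 * L ≤ T) {α₀ : ℝ} (hα₀ : 0 ≤ α₀) (hsmall : 512 * (d + 1) * (d + 4) * (L : ℝ) ^ 2 * α₀ ≤ 1)
    (h44 : ∀ (x : B7Prop1Explicit.Site d) (κ κ' : Fin d), κ ≠ κ' → ‖((hol V x (plaqWord κ κ') : M₂ˣ) : M₂) - 1‖ ≤ α₀)
    (y : (Fin d × Fin d) × B7Prop1Explicit.Site d) (hy : y.1 ∈ planes) :
    ‖psiQ L V y - ∑ x ∈ pbox planes T, pker T L y x • PhiQ T L V y x‖
      ≤ 280 * (8 * (d + 1) * (d + 4) * (L : ℝ) ^ 2 * α₀) ^ 2 := by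
  rw [pker_sum_eq T L planes hy (PhiQ T L V y)]
  have hΦ : ∀ x : B7Prop1Explicit.Site d, PhiQ T L V y (y.1, x)
      = topRowQuat (textend T L y.1.1 y.1.2 ((L : ℤ) • y.2) (GM L V y) (phiM V y.1) x) := fun x => by
    simp only [PhiQ, if_true]
  simp only [hΦ]
  exact bch_torus_quat T L y.1.1 y.1.2 hL h2L y.2 (hplanes _ hy) V hV hα₀ hsmall h44 _ rfl (phiM V y.1) rfl
    (GM L V y) rfl

/-- **The Wilson weights in `V = ℍ`** (representation binders `hreprU`/`hreprL` for `SU(2)` with `e v = 1 − cos ‖v‖`):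
`1 − ½ Re Tr V(∂p_x) = 1 − cos ‖φ_Q(x)‖_ℍ` and `1 − ½ Re Tr V̄(∂p′_y) = 1 − cos ‖ψ_Q(y)‖_ℍ` under (44) with the Prop. 2
smallness. [folklore] -/
theorem wilson_phiQ_psiQ (L : ℕ) {V : B7Prop1Explicit.Site d → Fin d → M₂ˣ}
    (hV : ∀ x κ, V x κ ∈ specialUnitaryUnits (Fin 2)) (hL : 1 ≤ L) {α₀ : ℝ} (hα₀ : 0 ≤ α₀)
    (hsmall : 512 * (d + 1) * (d + 4) * (L : ℝ) ^ 2 * α₀ ≤ 1)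
    (h44 : ∀ (x : B7Prop1Explicit.Site d) (κ κ' : Fin d), κ ≠ κ' → ‖((hol V x (plaqWord κ κ') : M₂ˣ) : M₂) - 1‖ ≤ α₀)
    (x y : (Fin d × Fin d) × B7Prop1Explicit.Site d) (hx : x.1.1 ≠ x.1.2) (hy : y.1.1 ≠ y.1.2) :
    1 - (Matrix.trace ((hol V x.2 (plaqWord x.1.1 x.1.2) : M₂ˣ) : M₂)).re / 2 = 1 - Real.cos ‖phiQ V x‖ ∧
      1 - (Matrix.trace ((cplaq L (bavg L V) ((L : ℤ) • y.2) y.1.1 y.1.2 : M₂ˣ) : M₂)).re / 2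
        = 1 - Real.cos ‖psiQ L V y‖ := by
  obtain ⟨hθ, hαθ, -⟩ := theta_bounds hL hα₀ hsmall
  exact ⟨wilsonWeight_eq (hol_mem_SU hV x.2 _) (by linarith [h44 x.2 _ _ hx]),
    wilsonWeight_eq (cplaq_mem_SU L (bavg_mem_SU hV L hL hα₀ hsmall h44) _ _ _)
      (mlog_cplaq_bavg_mem_range hV L hL hα₀ hsmall h44 _ hy).1⟩

/-- `φ_Q`, `ψ_Q` are imaginary quaternions (`su(2) ≅ Im ℍ`). [folklore] -/
theorem re_phiQ_psiQ (L : ℕ) {V : B7Prop1Explicit.Site d → Fin d → M₂ˣ}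
    (hV : ∀ x κ, V x κ ∈ specialUnitaryUnits (Fin 2)) (hL : 1 ≤ L) {α₀ : ℝ} (hα₀ : 0 ≤ α₀)
    (hsmall : 512 * (d + 1) * (d + 4) * (L : ℝ) ^ 2 * α₀ ≤ 1)
    (h44 : ∀ (x : B7Prop1Explicit.Site d) (κ κ' : Fin d), κ ≠ κ' → ‖((hol V x (plaqWord κ κ') : M₂ˣ) : M₂) - 1‖ ≤ α₀)
    (x y : (Fin d × Fin d) × B7Prop1Explicit.Site d) (hx : x.1.1 ≠ x.1.2) (hy : y.1.1 ≠ y.1.2) :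
    (phiQ V x).re = 0 ∧ (psiQ L V y).re = 0 :=
  ⟨(re_data_eq_zero L x.1.1 x.1.2 hV hL hα₀ hsmall h44 hx ((L : ℤ) • y.2) x.2).2,
    (re_data_eq_zero L y.1.1 y.1.2 hV hL hα₀ hsmall h44 hy ((L : ℤ) • y.2) x.2).1⟩

end Planes

/-! ## §5 Toys (non-vacuity) -/

section Toy

/-- Parallel transports of the constant configuration `1` are `1` (membership in the trivial subgroup). [folklore] -/
theorem hol_const_one {d : ℕ} (x : B7Prop1Explicit.Site d) (w : List (Letter d)) :
    hol (fun (_ : B7Prop1Explicit.Site d) (_ : Fin d) => (1 : M₂ˣ)) x w = 1 := by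
  have h : hol (fun (_ : B7Prop1Explicit.Site d) (_ : Fin d) => (1 : M₂ˣ)) x w ∈ (⊥ : Subgroup M₂ˣ) :=
    hol_mem_of (fun _ _ => Subgroup.mem_bot.2 rfl) x w
  rwa [Subgroup.mem_bot] at h

/-- Non-vacuity of `bch_PhiQ`: the constant `SU(2)` configuration `1` on the two-dimensional torus of side `T = 4`,
`L = 2`, meets every hypothesis with `α₀ = 0`. [folklore] -/
example (planes : Finset (Fin 2 × Fin 2)) (hplanes : ∀ P ∈ planes, P.1 ≠ P.2)
    (y : (Fin 2 × Fin 2) × B7Prop1Explicit.Site 2) (hy : y.1 ∈ planes) :=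
  bch_PhiQ 4 2 planes hplanes (V := fun _ _ => 1) (fun _ _ => Subgroup.one_mem _) (by norm_num) (by norm_num)
    (α₀ := 0) le_rfl (by norm_num) (fun x κ κ' _ => by rw [hol_const_one]; simp) y hy

/-- Non-vacuity of `norm_PhiQ`: the same configuration is `4`-periodic. [folklore] -/
example (y x : (Fin 2 × Fin 2) × B7Prop1Explicit.Site 2) (hy : y.1.1 ≠ y.1.2) :=
  norm_PhiQ 4 2 (V := fun _ _ => 1) (fun _ _ => Subgroup.one_mem _) (fun _ _ => rfl) (by norm_num)
    (α₀ := 0) le_rfl (by norm_num) (fun x κ κ' _ => by rw [hol_const_one]; simp) y hy x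

/-- Non-vacuity of `wilsonWeight_eq`: at `U = 1` both sides are `0`. [folklore] -/
example : 1 - (Matrix.trace ((1 : M₂ˣ) : M₂)).re / 2 = 1 - Real.cos ‖topRowQuat (MatrixLog.mlog ((1 : M₂ˣ) : M₂))‖ :=
  wilsonWeight_eq (Subgroup.one_mem _) (by simp)

end Toy

end Literature.MathematicalPhysics.QuantumFieldTheory.Balaban1983to89.T4TermwiseSU2
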